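import Summits.Ventures.PercRepro.Night2StarPairs

/-!
# PercRepro — night-2: cross-line pairs of triangle points pay `1/(9(q + 1))`; eighteen of them give `(★)`
(blind cell pub-perc-repro, night-2 gen 1, on `Night2StarPairs`)

A TRIANGLE point of a basis `B` is an `x ∈ G ∖ B` whose fundamental circuit has three points, i.e. `m(B ∪ {x}) = q − 2`; its
B-LINE is the pair `ncl(B ∪ {x}) ∖ {x} ⊆ B`. Two triangle points on DIFFERENT B-lines form a CROSS pair `{x, y}`:
`m(B ∪ {x, y}) ≤ q − 3` (the coloops of the pair lie in `B` minus both lines, `mem_coloopsOf_insert_insert`'s converse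
direction `mTr_insert_insert_le`) and `b(B ∪ {x, y}) ≤ 9` (`bIn_insert_insert_le`), so the pair pays
`[q/(q − 2) − (q + 2)/(q + 1)]/9 = (q + 4)/(9(q − 2)(q + 1)) ≥ 1/(9(q + 1))` (`cross_pair_term_ge`), and
* **`rec_ge_of_cross_pairs`** — a basis with at least `18` cross pairs receives `rec(B) ≥ 2/(q + 1)`
  (Theorem 11(iii) of `proofs/NIGHT-2-star.md` in its kernel form; the paper's bound `1/8` uses `t ≤ 1` more finely).
-/

namespace PercRepro.Star

open Finset ThmH SixFour GenQ

variable {α : Type*} [DecidableEq α] {M : Matroid α} [M.Finite]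

/-- The cyclic part of the single `B ∪ {x}` (its fundamental circuit). -/
noncomputable def circ (M : Matroid α) [M.Finite] (B : Finset α) (x : α) : Finset α :=
  (insert x B) \ coloopsOf M (insert x B)

/-- `x` is a triangle point of `B` (fundamental circuit of three points) and `y` is another one on a different
B-line: a CROSS pair. -/
def CrossPair (M : Matroid α) [M.Finite] (B : Finset α) (q : ℕ) (x y : α) : Prop :=
  mTr M (insert x B) + 2 = q ∧ mTr M (insert y B) + 2 = q ∧ (circ M B x).erase x ≠ (circ M B y).erase y

/-- The coloops of the pair lie in the coloops of both singles. -/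
theorem coloopsOf_insert_insert_subset {G B : Finset α} {q : ℕ} (hG : G ⊆ gr M)
    (hrG : M.eRk (G : Set α) = (q : ℕ∞)) (hB : B ∈ Bq M G q) {x y : α} (hx : x ∈ G \ B) (hy : y ∈ G \ B)
    (hxy : x ≠ y) :
    coloopsOf M (insert x (insert y B)) ⊆ coloopsOf M (insert x B) ∩ coloopsOf M (insert y B) := by
  intro w hw
  rw [Finset.mem_inter]
  constructor
  · -- symmetric form: `insert x (insert y B) = insert y (insert x B)`
    have hw' : w ∈ coloopsOf M (insert y (insert x B)) := by
      rw [Finset.insert_comm]; exact hw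
    have hwS := (mem_coloopsOf.1 hw').1
    have hwy : w ≠ y := by
      intro h
      subst h
      apply (mem_coloopsOf.1 hw').2
      have hyxB : w ∉ insert x B := by
        rw [Finset.mem_insert, not_or]
        exact ⟨Ne.symm hxy, (Finset.mem_sdiff.1 hy).2⟩
      rw [Finset.erase_insert hyxB]
      exact M.closure_subset_closure (Finset.coe_subset.2 (Finset.subset_insert x B))
        (mem_closure_of_mem_sdiff hG hrG hB hy)
    have hw'' : w ∈ insert x B := by
      rcases Finset.mem_insert.1 hwS with h | h
      · exact absurd h hwy
      · exact h
    exact mem_coloopsOf_of_subset (Finset.subset_insert y (insert x B)) hw'' hw'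
  · have hwS := (mem_coloopsOf.1 hw).1
    have hwx : w ≠ x := by
      intro h
      subst h
      apply (mem_coloopsOf.1 hw).2
      have hxyB : w ∉ insert y B := by
        rw [Finset.mem_insert, not_or]
        exact ⟨hxy, (Finset.mem_sdiff.1 hx).2⟩
      rw [Finset.erase_insert hxyB]
      exact M.closure_subset_closure (Finset.coe_subset.2 (Finset.subset_insert y B))
        (mem_closure_of_mem_sdiff hG hrG hB hx)
    have hw'' : w ∈ insert y B := by
      rcases Finset.mem_insert.1 hwS with h | h
      · exact absurd h hwx
      · exact h
    exact mem_coloopsOf_of_subset (Finset.subset_insert x (insert y B)) hw'' hw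

/-- The coloops of the single `B ∪ {x}` are `B ∖ (line of x)`. -/
theorem coloopsOf_insert_eq {G B : Finset α} {q : ℕ} (hG : G ⊆ gr M)
    (hrG : M.eRk (G : Set α) = (q : ℕ∞)) (hB : B ∈ Bq M G q) {x : α} (hx : x ∈ G \ B) :
    coloopsOf M (insert x B) = B \ (circ M B x).erase x := by
  have hxB := (Finset.mem_sdiff.1 hx).2
  have hxc : x ∉ coloopsOf M (insert x B) := notMem_coloopsOf_insert hG hrG hB hx
  ext w
  unfold circ
  simp only [Finset.mem_sdiff, Finset.mem_erase, Finset.mem_insert, not_and, not_not]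
  constructor
  · intro hw
    have hwB : w ∈ B := by
      rcases Finset.mem_insert.1 (coloopsOf_subset _ hw) with h | h
      · exact absurd (h ▸ hw) hxc
      · exact h
    exact ⟨hwB, fun _ _ => hw⟩
  · rintro ⟨hwB, h⟩
    have hwx : w ≠ x := fun h' => hxB (h' ▸ hwB)
    exact h hwx (Or.inr hwB)

/-- A triangle point has a two-point B-line. -/
theorem card_line_of_triangle {G B : Finset α} {q : ℕ} (hG : G ⊆ gr M)
    (hrG : M.eRk (G : Set α) = (q : ℕ∞)) (hB : B ∈ Bq M G q) {x : α} (hx : x ∈ G \ B)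
    (hm : mTr M (insert x B) + 2 = q) : ((circ M B x).erase x).card = 2 := by
  obtain ⟨hSx, hcx⟩ := insert_mem_SNq hrG hB hx
  have hxin : x ∈ circ M B x := by
    unfold circ
    exact Finset.mem_sdiff.2 ⟨Finset.mem_insert_self x B, notMem_coloopsOf_insert hG hrG hB hx⟩
  have hcard : (circ M B x).card = q + 1 - mTr M (insert x B) := by
    unfold circ
    rw [Finset.card_sdiff_of_subset (coloopsOf_subset _), hcx]
    rfl
  rw [Finset.card_erase_of_mem hxin, hcard]
  omega

/-- `(line of x) ⊆ B`. -/
theorem line_subset {B : Finset α} {x : α} : (circ M B x).erase x ⊆ B := by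
  intro w hw
  rw [Finset.mem_erase] at hw
  have := (Finset.mem_sdiff.1 hw.2).1
  rcases Finset.mem_insert.1 this with h | h
  · exact absurd h hw.1
  · exact h

/-- A cross pair has at most `q − 3` coloops. -/
theorem mTr_add_three_le_of_crossPair {G B : Finset α} {q : ℕ} (hG : G ⊆ gr M)
    (hrG : M.eRk (G : Set α) = (q : ℕ∞)) (hB : B ∈ Bq M G q) {x y : α} (hx : x ∈ G \ B) (hy : y ∈ G \ B)
    (hxy : x ≠ y) (hc : CrossPair M B q x y) : mTr M (insert x (insert y B)) + 3 ≤ q := by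
  obtain ⟨hmx, hmy, hne⟩ := hc
  have hsub := coloopsOf_insert_insert_subset hG hrG hB hx hy hxy
  rw [coloopsOf_insert_eq hG hrG hB hx, coloopsOf_insert_eq hG hrG hB hy, ← Finset.sdiff_union_distrib] at hsub
  have hcx := card_line_of_triangle hG hrG hB hx hmx
  have hcy := card_line_of_triangle hG hrG hB hy hmy
  have hLxB : (circ M B x).erase x ⊆ B := line_subset
  have hLyB : (circ M B y).erase y ⊆ B := line_subset
  have hunion : 3 ≤ ((circ M B x).erase x ∪ (circ M B y).erase y).card := by
    by_contra hlt
    push Not at hlt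
    have h1 : (circ M B x).erase x ⊆ (circ M B x).erase x ∪ (circ M B y).erase y := Finset.subset_union_left
    have h2 : (circ M B y).erase y ⊆ (circ M B x).erase x ∪ (circ M B y).erase y := Finset.subset_union_right
    have e1 := Finset.eq_of_subset_of_card_le h1 (by omega)
    have e2 := Finset.eq_of_subset_of_card_le h2 (by omega)
    exact hne (e1.trans e2.symm)
  have hu : ((circ M B x).erase x ∪ (circ M B y).erase y).card ≤ B.card :=
    Finset.card_le_card (Finset.union_subset hLxB hLyB)
  have hm := Finset.card_le_card hsub
  rw [Finset.card_sdiff_of_subset (Finset.union_subset hLxB hLyB)] at hm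
  rw [(mem_Bq.1 hB).2.2] at hm hu
  unfold mTr
  omega

/-- **A cross pair pays `1/(9(q + 1))`.** -/
theorem cross_pair_term_ge {G B : Finset α} {q : ℕ} (hG : G ⊆ gr M)
    (hrG : M.eRk (G : Set α) = (q : ℕ∞)) (hB : B ∈ Bq M G q) {x y : α} (hx : x ∈ G \ B) (hy : y ∈ G \ B)
    (hxy : x ≠ y) (hc : CrossPair M B q x y) :
    1 / (9 * ((q : ℚ) + 1)) ≤ surplus M G q (insert x (insert y B)) / (bIn M G q (insert x (insert y B)) : ℚ) := by
  have hm := mTr_add_three_le_of_crossPair hG hrG hB hx hy hxy hc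
  have hbb := bIn_insert_insert_le hG hrG hB hx hy hxy
  obtain ⟨hSx, hcx⟩ := insert_mem_SNq hrG hB hx
  obtain ⟨hSy, hcy⟩ := insert_mem_SNq hrG hB hy
  obtain ⟨hS2, -⟩ := insert_insert_mem_SNq hrG hB hx hy hxy
  obtain ⟨hS2G, hr2, -⟩ := mem_SNq.1 hS2
  have hbpos := bIn_pos hG hS2G hr2
  have hcxc : ((insert x B) \ coloopsOf M (insert x B)).card = 3 := by
    rw [Finset.card_sdiff_of_subset (coloopsOf_subset _), hcx]
    have h1 := hc.1
    unfold mTr at h1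
    omega
  have hcyc : ((insert y B) \ coloopsOf M (insert y B)).card = 3 := by
    rw [Finset.card_sdiff_of_subset (coloopsOf_subset _), hcy]
    have h1 := hc.2.1
    unfold mTr at h1
    omega
  rw [hcxc, hcyc] at hbb
  set m : ℚ := (mTr M (insert x (insert y B)) : ℚ) with hm_def
  set b : ℚ := (bIn M G q (insert x (insert y B)) : ℚ) with hb_def
  have hm0 : (0 : ℚ) ≤ m := by rw [hm_def]; positivity
  have hmq : m + 3 ≤ q := by rw [hm_def]; exact_mod_cast hm
  have hb9 : b ≤ 9 := by rw [hb_def]; exact_mod_cast hbb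
  have hb1 : (1 : ℚ) ≤ b := by rw [hb_def]; exact_mod_cast hbpos
  have hq1 : (0 : ℚ) < (q : ℚ) + 1 := by positivity
  have hsur := surplus_ge_dem (M := M) (G := G) (S := insert x (insert y B)) q
  unfold wInf at hsur
  rw [mul_one_div, ← hm_def] at hsur
  have hnum : 1 / ((q : ℚ) + 1) ≤ (q : ℚ) / (1 + m) - ((q : ℚ) + 2) / ((q : ℚ) + 1) := by
    have h1m : (0 : ℚ) < 1 + m := by linarith
    rw [div_sub_div _ _ h1m.ne' hq1.ne', div_le_div_iff₀ hq1 (by positivity)]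
    have hA : (1 + m) * ((q : ℚ) + 3) ≤ ((q : ℚ) - 2) * ((q : ℚ) + 3) :=
      mul_le_mul_of_nonneg_right (by linarith) (by linarith)
    nlinarith [hA, hq1]
  calc 1 / (9 * ((q : ℚ) + 1)) = (1 / ((q : ℚ) + 1)) / 9 := by rw [div_div, mul_comm]
    _ ≤ ((q : ℚ) / (1 + m) - ((q : ℚ) + 2) / ((q : ℚ) + 1)) / b := by
        have h0 : (0 : ℚ) ≤ 1 / ((q : ℚ) + 1) := by positivity
        exact div_le_div₀ (h0.trans hnum) hnum (by linarith) hb9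
    _ ≤ surplus M G q (insert x (insert y B)) / b := by
        apply div_le_div_of_nonneg_right hsur (by linarith)


/-- **Eighteen cross pairs give `(★)`**: if `P` is a set of `2`-subsets `{x, y}` of `G ∖ B`, each a cross pair, with `|P| ≥ 18`,
then `rec(B) ≥ 2/(q + 1)`. -/
theorem rec_ge_of_cross_pairs (hs : Simple M) {G B : Finset α} {q : ℕ} (hG : G ⊆ gr M)
    (hrG : M.eRk (G : Set α) = (q : ℕ∞)) (hB : B ∈ Bq M G q) {P : Finset (Finset α)}
    (hP : P ⊆ (G \ B).powersetCard 2)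
    (hcross : ∀ p ∈ P, ∃ x y, x ≠ y ∧ p = {x, y} ∧ CrossPair M B q x y) (h18 : 18 ≤ P.card) :
    2 / ((q : ℚ) + 1) ≤ rec M G q B := by
  set f : Finset α → ℚ := fun S => surplus M G q S / (bIn M G q S : ℚ) with hf
  have hf0 : ∀ S ∈ (SNq M G q).filter (fun S : Finset α => B ⊆ S), 0 ≤ f S := by
    intro S hS
    have hS' := (Finset.mem_filter.1 hS).1
    apply div_nonneg (surplus_nonneg hs hG hrG hS')
    positivity
  -- each pair `p ⊆ G ∖ B` gives the set `p ∪ B`; the map is injective (`(p ∪ B) ∖ B = p`)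
  have hmem : ∀ p ∈ P, p ⊆ G \ B ∧ p.card = 2 := fun p hp => by
    have := Finset.mem_powersetCard.1 (hP hp)
    exact ⟨this.1, this.2⟩
  have hinj : Set.InjOn (fun p : Finset α => p ∪ B) (P : Set (Finset α)) := by
    intro p hp p' hp' heq
    have h1 : p ∩ B = ∅ := by
      rw [Finset.eq_empty_iff_forall_notMem]
      intro z hz
      exact (Finset.mem_sdiff.1 ((hmem p (Finset.mem_coe.1 hp)).1 (Finset.mem_inter.1 hz).1)).2
        (Finset.mem_inter.1 hz).2
    have h2 : p' ∩ B = ∅ := by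
      rw [Finset.eq_empty_iff_forall_notMem]
      intro z hz
      exact (Finset.mem_sdiff.1 ((hmem p' (Finset.mem_coe.1 hp')).1 (Finset.mem_inter.1 hz).1)).2
        (Finset.mem_inter.1 hz).2
    have e1 : (p ∪ B) \ B = p := by
      rw [Finset.union_sdiff_right, Finset.sdiff_eq_self_iff_disjoint, Finset.disjoint_iff_inter_eq_empty]
      exact h1
    have e2 : (p' ∪ B) \ B = p' := by
      rw [Finset.union_sdiff_right, Finset.sdiff_eq_self_iff_disjoint, Finset.disjoint_iff_inter_eq_empty]
      exact h2
    simp only at heq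
    rw [← e1, ← e2, heq]
  set T : Finset (Finset α) := P.image (fun p => p ∪ B) with hT
  have hTsub : T ⊆ (SNq M G q).filter (fun S : Finset α => B ⊆ S) := by
    intro S hS
    rw [hT, Finset.mem_image] at hS
    obtain ⟨p, hp, rfl⟩ := hS
    obtain ⟨x, y, hxy, rfl, -⟩ := hcross p hp
    have hx : x ∈ G \ B := (hmem _ hp).1 (by simp)
    have hy : y ∈ G \ B := (hmem _ hp).1 (by simp)
    have e : ({x, y} : Finset α) ∪ B = insert x (insert y B) := by
      ext z
      simp only [Finset.mem_union, Finset.mem_insert, Finset.mem_singleton]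
      tauto
    rw [e]
    exact Finset.mem_filter.2 ⟨(insert_insert_mem_SNq hrG hB hx hy hxy).1,
      (Finset.subset_insert y B).trans (Finset.subset_insert x _)⟩
  have hrec : ∑ S ∈ T, f S ≤ rec M G q B := by
    unfold rec
    apply Finset.sum_le_sum_of_subset_of_nonneg hTsub
    intro S hS _
    exact hf0 S hS
  rw [hT, Finset.sum_image hinj] at hrec
  have hterm : ∀ p ∈ P, 1 / (9 * ((q : ℚ) + 1)) ≤ f (p ∪ B) := by
    intro p hp
    obtain ⟨x, y, hxy, rfl, hc⟩ := hcross p hp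
    have hx : x ∈ G \ B := (hmem _ hp).1 (by simp)
    have hy : y ∈ G \ B := (hmem _ hp).1 (by simp)
    have e : ({x, y} : Finset α) ∪ B = insert x (insert y B) := by
      ext z
      simp only [Finset.mem_union, Finset.mem_insert, Finset.mem_singleton]
      tauto
    rw [e]
    exact cross_pair_term_ge hG hrG hB hx hy hxy hc
  have hsum : P.card • (1 / (9 * ((q : ℚ) + 1))) ≤ ∑ p ∈ P, f (p ∪ B) :=
    Finset.card_nsmul_le_sum P _ _ hterm
  rw [nsmul_eq_mul] at hsum
  have h18' : (18 : ℚ) ≤ P.card := by exact_mod_cast h18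
  have hq1 : (0 : ℚ) < (q : ℚ) + 1 := by positivity
  have hkey : 2 / ((q : ℚ) + 1) = 18 * (1 / (9 * ((q : ℚ) + 1))) := by
    field_simp
    ring
  have h2 : 18 * (1 / (9 * ((q : ℚ) + 1))) ≤ (P.card : ℚ) * (1 / (9 * ((q : ℚ) + 1))) :=
    mul_le_mul_of_nonneg_right h18' (by positivity)
  rw [hkey]
  simp only [hf] at hrec hsum
  linarith

end PercRepro.Star
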